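import Mathlib
import Literature.Computability.AlgebraicComplexity.PermanentIrreducible
import Literature.Computability.AlgebraicComplexity.VonZurGathenSingPermHeight
import Literature.LinearAlgebra.Matrix.PermanentSubperm
import Summits.ValiantsHypothesis.ValiantsHypothesis.Theorems.PolyaContinuedLaplaceRigidityTwoLineBilinear
import Summits.ValiantsHypothesis.ValiantsHypothesis.Theorems.PolyaContinuedLaplaceRigidityTwoLineForms
import HarnessLib

/-!
# The two-line case of top-prime rigidity, part 3 (C-ii): the certified point, the `8 × 8` dichotomy, and
# ★ `twoLineCase_of_topPrimeRigidity : TopPrimeRigidity → TwoLineCase`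

Helper file for crux `CoverDecancellation` (stmt-ValiantsHypothesis-17819), route `PolyaContinued`, line
`component_rigidity` (val-idea-10 g3): the registered stub C `stub_twoLineCase_of_topPrimeRigidity` PROVED, with the
line's `TopPrimeRigidity` / `TwoLineCase` / `cellIdeal` / `rowCol` / `twoRows` / `twoCols` UNFOLDED (as in p624852), so
that the line file takes `theorem stub_twoLineCase_of_topPrimeRigidity := TwoLine.twoLineCase_of_topPrimeRigidity` by
`δ`.  Architecture = 17819-w1 g2's (line card §v4, memo `Lines/laplace_rigidity_width4_notes.md` §«Stub C is cheap GIVEN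
B»), point CERTIFIED by val-idea-crit-3 g3 (PRICE 3): `A = [(1,1,1,1); (1,−1,1,1); (0,0,0,0); (1,0,−1,0)]`.

Proof.  WLOG the two lines are the rows `{0,1}` (`rename` by a row permutation / by the transpose fixes `per₄`, maps the
variable ideal of two lines onto that of two lines and preserves homogeneity: `exists_decomposition_rename`).  By C-i
(`TwoLine.bilinear_projection`) `per₄ = Σ_{k<4} a_k a'_k` with eight BILINEAR forms across (rows `0,1` | rows `2,3`).
Fix the rows-`{0,1}` values `y₀ = ((1,1,1,1),(1,−1,1,1))` and let `N(y₀)` be the `8 × 8` matrix of the linear forms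
`z ↦ a_k(y₀,z), a'_k(y₀,z)` on the rows-`{2,3}` block `z ∈ ℂ^{2×4}` (`TwoLine.eval_bilinear`,
`TwoLine.eval_pderiv_bilinear`).  DICHOTOMY (`Matrix.exists_mulVec_eq_zero_iff`): if `det N(y₀) = 0`, a kernel vector
`z₀ ≠ 0` makes `(y₀; z₀)` a common zero of the eight forms, hence (C-ii algebraic half `TwoLine.commonZero_twoLines`, where
TOP-PRIME RIGIDITY enters) a matrix with two zero rows or two zero columns — impossible, `y₀` has no zero entry and
`z₀ ≠ 0`; if `det N(y₀) ≠ 0`, differentiate `per₄ = Σ a_k a'_k` in the eight rows-`{2,3}` variables at `A = (y₀; z*)`,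
`z* = ((0,0,0,0),(1,0,−1,0))`: all these partials of `per₄` vanish at `A` (the `3 × 3` sub-permanents of `A`, checked by
`decide` over `ℤ`, `VonZurGathen.pderiv_perPoly`), so `w ᵥ* N(y₀) = 0` for `w = (a'(A), a(A))`, whence `w = 0`
(`Matrix.eq_zero_of_vecMul_eq_zero`), i.e. `N(y₀) z* = 0` with `z* ≠ 0` — so `det N(y₀) = 0` after all.

HONEST FRAMING: this closes ONE of the line's three registered stubs (C); stub B (`stub_kcore_noVar`, `stub_kcore_noBinomial`,
17819-w1 g2's T7/T8) stays OPEN, so the rung `str₂(per₄) ≥ 5` (`StrengthTwoPerFourGeFive`) is NOT yet a theorem; crux 17819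
`CoverDecancellation` stays HELD (the rung does not bear on it); nothing here bears on `VP ≠ VNP`, which is NOT proved.
[cite: GesmundoGhosalIkenmeyerLysikov2022, Prop. 6]
-/

set_option autoImplicit false

-- the mandated summit-side namespace repeats a component by design (single-problem summit)
set_option linter.dupNamespace false

noncomputable section

open MvPolynomial

namespace Summit.ValiantsHypothesis.ValiantsHypothesis.Theorems.PolyaContinuedLaplaceRigidity

namespace TwoLine

open Literature.Computability.AlgebraicComplexity

/-! ## Transport: row permutations and the transpose fix `per₄` and move two-line ideals -/

/-- `per₄` is invariant under permuting the rows. [folklore] -/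
theorem rename_rowPerm_perPoly (σ : Equiv.Perm (Fin 4)) :
    rename (fun e : Fin 4 × Fin 4 => (σ e.1, e.2)) (perPoly (Fin 4) ℂ) = perPoly (Fin 4) ℂ := by
  simp only [perPoly, Matrix.permanent, map_sum, map_prod, Matrix.mvPolynomialX_apply, rename_X]
  exact Fintype.sum_equiv (Equiv.mulLeft σ) _ _ fun τ => by simp [Equiv.Perm.mul_apply]

/-- `per₄` is invariant under the transpose. [folklore] -/
theorem rename_swap_perPoly :
    rename (Prod.swap : Fin 4 × Fin 4 → Fin 4 × Fin 4) (perPoly (Fin 4) ℂ) = perPoly (Fin 4) ℂ := by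
  have h : rename (Prod.swap : Fin 4 × Fin 4 → Fin 4 × Fin 4) (perPoly (Fin 4) ℂ) =
      ((Matrix.mvPolynomialX (Fin 4) (Fin 4) ℂ).transpose).permanent := by
    simp [perPoly, Matrix.permanent, map_sum, map_prod, Matrix.mvPolynomialX, rename_X]
  rw [h, Matrix.permanent_transpose]
  rfl

/-- **Transport of a two-factor decomposition along a variable renaming fixing `per₄`.** -/
theorem exists_decomposition_rename (g : Fin 4 × Fin 4 → Fin 4 × Fin 4)
    (hg : rename g (perPoly (Fin 4) ℂ) = perPoly (Fin 4) ℂ) (S S' : Finset (Fin 4 × Fin 4))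
    (hSS' : ∀ e ∈ S, g e ∈ S') (p q : Fin 4 → MvPolynomial (Fin 4 × Fin 4) ℂ)
    (hp : ∀ k, p k ∈ Ideal.span ((fun e => (X e : MvPolynomial (Fin 4 × Fin 4) ℂ)) '' (S : Set _)))
    (hq : ∀ k, q k ∈ Ideal.span ((fun e => (X e : MvPolynomial (Fin 4 × Fin 4) ℂ)) '' (S : Set _)))
    (hpq : (∀ k, (p k).IsHomogeneous 2) ∧ (∀ k, (q k).IsHomogeneous 2) ∧
      perPoly (Fin 4) ℂ = ∑ k, p k * q k) :
    ∃ p' q' : Fin 4 → MvPolynomial (Fin 4 × Fin 4) ℂ,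
      (∀ k, p' k ∈ Ideal.span ((fun e => (X e : MvPolynomial (Fin 4 × Fin 4) ℂ)) '' (S' : Set _))) ∧
      (∀ k, q' k ∈ Ideal.span ((fun e => (X e : MvPolynomial (Fin 4 × Fin 4) ℂ)) '' (S' : Set _))) ∧
      (∀ k, (p' k).IsHomogeneous 2) ∧ (∀ k, (q' k).IsHomogeneous 2) ∧
      perPoly (Fin 4) ℂ = ∑ k, p' k * q' k := by
  obtain ⟨hp2, hq2, hf⟩ := hpq
  have hmap : ∀ f : MvPolynomial (Fin 4 × Fin 4) ℂ,
      f ∈ Ideal.span ((fun e => (X e : MvPolynomial (Fin 4 × Fin 4) ℂ)) '' (S : Set _)) →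
        rename g f ∈ Ideal.span ((fun e => (X e : MvPolynomial (Fin 4 × Fin 4) ℂ)) '' (S' : Set _)) := by
    intro f hf
    have h1 : rename g f ∈ Ideal.map (rename g : MvPolynomial (Fin 4 × Fin 4) ℂ →ₐ[ℂ] _)
        (Ideal.span ((fun e => (X e : MvPolynomial (Fin 4 × Fin 4) ℂ)) '' (S : Set _))) :=
      Ideal.mem_map_of_mem _ hf
    rw [Ideal.map_span] at h1
    refine Ideal.span_mono ?_ h1
    rintro _ ⟨_, ⟨e, he, rfl⟩, rfl⟩
    exact ⟨g e, Finset.mem_coe.2 (hSS' e (Finset.mem_coe.1 he)), by simp [rename_X]⟩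
  refine ⟨fun k => rename g (p k), fun k => rename g (q k), fun k => hmap _ (hp k), fun k => hmap _ (hq k),
    fun k => (hp2 k).rename_isHomogeneous, fun k => (hq2 k).rename_isHomogeneous, ?_⟩
  have := congrArg (rename g) hf
  rw [hg, map_sum] at this
  simpa only [map_mul] using this

/-- for `i ≠ i'` some row permutation sends `i ↦ 0`, `i' ↦ 1` -/
theorem exists_perm_apply_eq_zero_one : ∀ i i' : Fin 4, i ≠ i' →
    ∃ σ : Equiv.Perm (Fin 4), σ i = 0 ∧ σ i' = 1 := by
  intro i i' h
  refine ⟨(Equiv.swap i 0).trans (Equiv.swap (Equiv.swap i 0 i') 1), ?_, ?_⟩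
  · have h1 : Equiv.swap i 0 i' ≠ 0 := fun e =>
      h ((Equiv.swap i 0).injective ((Equiv.swap_apply_left i 0).trans e.symm))
    rw [Equiv.trans_apply, Equiv.swap_apply_left, Equiv.swap_apply_of_ne_of_ne h1.symm (by decide)]
  · rw [Equiv.trans_apply, Equiv.swap_apply_left]

/-! ## The `8 × 8` matrix of the bilinear forms at a point with prescribed rows `0, 1` -/

/-- the complement of the rows `{0,1}` enumerated by `Fin 2 × Fin 4` via the rows `2, 3` -/
theorem sum_compl_rows01 {M : Type*} [AddCommMonoid M] (f : Fin 4 × Fin 4 → M) :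
    ∑ t ∈ (Finset.univ.filter fun e : Fin 4 × Fin 4 => e.1 = 0 ∨ e.1 = 1)ᶜ, f t =
      ∑ rc : Fin 2 × Fin 4, f ((![2, 3] : Fin 2 → Fin 4) rc.1, rc.2) := by
  have hc : (Finset.univ.filter fun e : Fin 4 × Fin 4 => e.1 = 0 ∨ e.1 = 1)ᶜ =
      Finset.univ.filter fun e : Fin 4 × Fin 4 => e.1 = 2 ∨ e.1 = 3 := by
    ext ⟨i, c⟩
    simp only [Finset.mem_compl, Finset.mem_filter, Finset.mem_univ, true_and]
    fin_cases i <;> simp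
  rw [hc, Finset.sum_filter, Fintype.sum_prod_type, Fintype.sum_prod_type, Fin.sum_univ_four, Fin.sum_univ_two]
  simp

/-- the cells `(2,c), (3,c)` lie outside the rows `{0,1}` -/
theorem rows23_mem_compl (rc : Fin 2 × Fin 4) :
    (((![2, 3] : Fin 2 → Fin 4) rc.1, rc.2) : Fin 4 × Fin 4) ∈
      (Finset.univ.filter fun e : Fin 4 × Fin 4 => e.1 = 0 ∨ e.1 = 1)ᶜ := by
  obtain ⟨r, c⟩ := rc
  rw [Finset.mem_compl, Finset.mem_filter]
  fin_cases r <;> simp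

/-- **Values of a rows-`{0,1}`-bilinear form at a point `x` through its rows-`{2,3}` block `v`**:
`eval x φ = Σ_{rc} (Σ_{s ∈ rows 0,1} coeff(e_s + e_{rc}, φ) · x_s) · v_{rc}` — the `8 × 8` matrix times `v`. -/
theorem eval_bilinear_rows01 {φ : MvPolynomial (Fin 4 × Fin 4) ℂ} (h2 : φ.IsHomogeneous 2)
    (h1 : IsWeightedHomogeneous (fun e : Fin 4 × Fin 4 =>
      if e ∈ (Finset.univ.filter fun e : Fin 4 × Fin 4 => e.1 = 0 ∨ e.1 = 1) then 1 else 0) φ 1)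
    (x : Fin 4 × Fin 4 → ℂ) (v : Fin 2 × Fin 4 → ℂ)
    (hxv : ∀ rc : Fin 2 × Fin 4, x ((![2, 3] : Fin 2 → Fin 4) rc.1, rc.2) = v rc) :
    eval x φ = ∑ rc : Fin 2 × Fin 4,
      (∑ s ∈ (Finset.univ.filter fun e : Fin 4 × Fin 4 => e.1 = 0 ∨ e.1 = 1),
        coeff (Finsupp.single s 1 + Finsupp.single (((![2, 3] : Fin 2 → Fin 4) rc.1, rc.2)) 1) φ * x s) * v rc := by
  rw [eval_bilinear _ h2 h1 x]
  simp_rw [sum_compl_rows01, hxv]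
  rw [Finset.sum_comm]
  refine Finset.sum_congr rfl fun rc _ => ?_
  rw [Finset.sum_mul]
  refine Finset.sum_congr rfl fun s _ => ?_
  ring

/-! ## The certified point `A = (y₀; z*)` -/

/-- **All rows-`{2,3}` partials of `per₄` vanish at the certified point** `A = [(1,1,1,1); (1,−1,1,1); (0,0,0,0);
(1,0,−1,0)]`: they are `3 × 3` sub-permanents of `A` (`VonZurGathen.pderiv_perPoly`), integers checked by `decide`
(crit-3 g3's certificate: `M(y₀)·(1,0,−1,0) = 0`). -/
theorem eval_pderiv_perPoly_certifiedPoint (r : Fin 2) (c : Fin 4) :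
    eval (fun e : Fin 4 × Fin 4 =>
        (((!![1, 1, 1, 1; 1, -1, 1, 1; 0, 0, 0, 0; 1, 0, -1, 0] : Matrix (Fin 4) (Fin 4) ℤ) e.1 e.2 : ℤ) : ℂ))
      (pderiv (((![2, 3] : Fin 2 → Fin 4) r, c) : Fin 4 × Fin 4) (perPoly (Fin 4) ℂ)) = 0 := by
  set Az : Matrix (Fin 4) (Fin 4) ℤ := !![1, 1, 1, 1; 1, -1, 1, 1; 0, 0, 0, 0; 1, 0, -1, 0] with hAz
  set A : Fin 4 × Fin 4 → ℂ := fun e => ((Az e.1 e.2 : ℤ) : ℂ) with hA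
  rw [VonZurGathen.pderiv_perPoly]
  have hmap : (Matrix.mvPolynomialX (Fin 4) (Fin 4) ℂ).map (eval A) = Az.map (Int.castRingHom ℂ) := by
    ext i j
    simp [Matrix.map_apply, Matrix.mvPolynomialX_apply, hA]
  have h := VonZurGathen.subperm_map (eval A) (Matrix.mvPolynomialX (Fin 4) (Fin 4) ℂ)
    (· ≠ c) (· ≠ ((![2, 3] : Fin 2 → Fin 4) r))
  rw [← h, hmap, VonZurGathen.subperm_map]
  have hz : ∀ r : Fin 2, ∀ c : Fin 4,
      Az.subperm (· ≠ c) (· ≠ ((![2, 3] : Fin 2 → Fin 4) r)) = 0 := by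
    rw [hAz]; decide
  rw [hz, map_zero]

/-! ## The rows-`{0,1}` case -/

/-- **The two-line case for the rows `{0,1}`** (the heart of stub C): under TOP-PRIME RIGIDITY, `per₄` has no width-4
two-factor decomposition by homogeneous quadrics all lying in the variable ideal of the rows `0, 1`. -/
theorem twoLineCase_rows01
    (hB : ∀ P : Ideal (MvPolynomial (Fin 4 × Fin 4) ℂ), P.IsPrime →
      VonZurGathen.singPermIdeal ℂ 4 ≤ P → P.height ≤ 8 →
        (∃ i c : Fin 4, ∀ f ∈ P, f.IsHomogeneous 2 →
            f ∈ Ideal.span ((fun e => (X e : MvPolynomial (Fin 4 × Fin 4) ℂ)) ''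
              ((Finset.univ.filter fun e : Fin 4 × Fin 4 => e.1 = i ∨ e.2 = c) : Set _))) ∨
        (∃ i i' : Fin 4, i ≠ i' ∧
          (P = Ideal.span ((fun e => (X e : MvPolynomial (Fin 4 × Fin 4) ℂ)) ''
              ((Finset.univ.filter fun e : Fin 4 × Fin 4 => e.1 = i ∨ e.1 = i') : Set _)) ∨
           P = Ideal.span ((fun e => (X e : MvPolynomial (Fin 4 × Fin 4) ℂ)) ''
              ((Finset.univ.filter fun e : Fin 4 × Fin 4 => e.2 = i ∨ e.2 = i') : Set _)))))
    (p q : Fin 4 → MvPolynomial (Fin 4 × Fin 4) ℂ)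
    (hp : ∀ k, p k ∈ Ideal.span ((fun e => (X e : MvPolynomial (Fin 4 × Fin 4) ℂ)) ''
      ((Finset.univ.filter fun e : Fin 4 × Fin 4 => e.1 = 0 ∨ e.1 = 1) : Set _)))
    (hq : ∀ k, q k ∈ Ideal.span ((fun e => (X e : MvPolynomial (Fin 4 × Fin 4) ℂ)) ''
      ((Finset.univ.filter fun e : Fin 4 × Fin 4 => e.1 = 0 ∨ e.1 = 1) : Set _))) :
    ¬ ((∀ k, (p k).IsHomogeneous 2) ∧ (∀ k, (q k).IsHomogeneous 2) ∧
        perPoly (Fin 4) ℂ = ∑ k, p k * q k) := by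
  classical
  rintro ⟨hp2, hq2, hf⟩
  set S : Finset (Fin 4 × Fin 4) := Finset.univ.filter fun e : Fin 4 × Fin 4 => e.1 = 0 ∨ e.1 = 1 with hS
  -- C-i: eight bilinear forms
  obtain ⟨ha, ha', hf'⟩ := bilinear_projection S
    (isWeightedHomogeneous_perPoly_twoRows (show (0 : Fin 4) ≠ 1 by decide)) p q hp hq hp2 hq2 hf
  set a : Fin 4 → MvPolynomial (Fin 4 × Fin 4) ℂ :=
    fun k => weightedHomogeneousComponent (fun e => if e ∈ S then 1 else 0) 1 (p k) with ha_def
  set a' : Fin 4 → MvPolynomial (Fin 4 × Fin 4) ℂ :=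
    fun k => weightedHomogeneousComponent (fun e => if e ∈ S then 1 else 0) 1 (q k) with ha'_def
  change ∀ k, (a k).IsHomogeneous 2 ∧ IsWeightedHomogeneous _ (a k) 1 at ha
  change ∀ k, (a' k).IsHomogeneous 2 ∧ IsWeightedHomogeneous _ (a' k) 1 at ha'
  change perPoly (Fin 4) ℂ = ∑ k, a k * a' k at hf'
  -- one family `φ (b, k)`: `b = 0 ↦ a k`, `b = 1 ↦ a' k`
  set φ : Fin 2 × Fin 4 → MvPolynomial (Fin 4 × Fin 4) ℂ :=
    fun bk => if bk.1 = 0 then a bk.2 else a' bk.2 with hφ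
  have hφ0 : ∀ k, φ (0, k) = a k := fun k => by simp [hφ]
  have hφ1 : ∀ k, φ (1, k) = a' k := fun k => by simp [hφ]
  have hφh : ∀ bk, (φ bk).IsHomogeneous 2 ∧
      IsWeightedHomogeneous (fun e => if e ∈ S then 1 else 0) (φ bk) 1 := by
    rintro ⟨b, k⟩
    fin_cases b
    · simpa [hφ] using ha k
    · simpa [hφ] using ha' k
  -- the point data
  set Az : Matrix (Fin 4) (Fin 4) ℤ := !![1, 1, 1, 1; 1, -1, 1, 1; 0, 0, 0, 0; 1, 0, -1, 0] with hAz
  set ρ : Fin 2 → Fin 4 := ![2, 3] with hρ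
  set pt : (Fin 2 × Fin 4 → ℂ) → (Fin 4 × Fin 4 → ℂ) := fun v e =>
    if e.1 = 2 then v (0, e.2) else if e.1 = 3 then v (1, e.2) else ((Az e.1 e.2 : ℤ) : ℂ) with hpt
  have hptS : ∀ v, ∀ s ∈ S, pt v s = ((Az s.1 s.2 : ℤ) : ℂ) := by
    intro v s hs
    rw [hS, Finset.mem_filter] at hs
    rcases hs.2 with h | h <;> simp [hpt, h]
  have hptz : ∀ v, ∀ rc : Fin 2 × Fin 4, pt v (ρ rc.1, rc.2) = v rc := by
    intro v ⟨r, c⟩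
    fin_cases r <;> simp [hpt, hρ]
  -- the 8 × 8 matrix `N(y₀)`
  set N : Matrix (Fin 2 × Fin 4) (Fin 2 × Fin 4) ℂ := fun bk rc =>
    ∑ s ∈ S, coeff (Finsupp.single s 1 + Finsupp.single ((ρ rc.1, rc.2) : Fin 4 × Fin 4) 1) (φ bk) *
      ((Az s.1 s.2 : ℤ) : ℂ) with hN
  -- the entries of `N` are the `y₀`-weighted coefficient sums at ANY point with rows `0,1` equal to `y₀`
  have hNpt : ∀ v bk rc, (∑ s ∈ S, coeff (Finsupp.single s 1 +
      Finsupp.single ((ρ rc.1, rc.2) : Fin 4 × Fin 4) 1) (φ bk) * pt v s) = N bk rc := by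
    intro v bk rc
    simp only [hN]
    exact Finset.sum_congr rfl fun s hs => by rw [hptS v s hs]
  -- KEY 1: values through `N`
  have key1 : ∀ v bk, eval (pt v) (φ bk) = (N.mulVec v) bk := by
    intro v bk
    rw [eval_bilinear_rows01 (hφh bk).1 (hφh bk).2 (pt v) v (hptz v)]
    simp only [Matrix.mulVec, dotProduct]
    exact Finset.sum_congr rfl fun rc _ => by rw [hNpt]
  -- KEY 2: partial derivatives in the rows-{2,3} variables are the entries of `N`
  have key2 : ∀ v bk rc, eval (pt v) (pderiv ((ρ rc.1, rc.2) : Fin 4 × Fin 4) (φ bk)) = N bk rc := by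
    intro v bk rc
    rw [eval_pderiv_bilinear S (hφh bk).1 (hφh bk).2 (pt v) (by rw [hρ]; exact rows23_mem_compl rc)]
    exact hNpt v bk rc
  -- DICHOTOMY on `det N`
  by_cases hdet : N.det = 0
  · -- singular: a kernel vector gives a common zero off every two-line space
    obtain ⟨v, hv0, hNv⟩ := Matrix.exists_mulVec_eq_zero_iff.2 hdet
    have hzero : ∀ bk, eval (pt v) (φ bk) = 0 := fun bk => by rw [key1, hNv]; rfl
    obtain ⟨i, i', hii', hcase⟩ := commonZero_twoLines hB (by simp) a a' (fun k => (ha k).1)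
      (fun k => (ha' k).1) hf' (pt v) (fun k => by rw [← hφ0]; exact hzero _)
      (fun k => by rw [← hφ1]; exact hzero _)
    have hrow01 : ∀ i₀ : Fin 4, (i₀ = 0 ∨ i₀ = 1) → pt v (i₀, 0) ≠ 0 := by
      rintro i₀ (rfl | rfl) <;> simp [hpt, hAz]
    rcases hcase with hrows | hcols
    · -- two zero rows: they must be the rows 2, 3, so `v = 0`
      have hi : ¬ (i = 0 ∨ i = 1) := fun h => hrow01 i h (hrows 0).1
      have hi' : ¬ (i' = 0 ∨ i' = 1) := fun h => hrow01 i' h (hrows 0).2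
      apply hv0
      funext ⟨r, c⟩
      have h23 : ∀ x : Fin 4, ¬ (x = 0 ∨ x = 1) → x = 2 ∨ x = 3 := by decide
      have hmem : ρ r = i ∨ ρ r = i' := by
        rcases h23 i hi with hi2 | hi3 <;> rcases h23 i' hi' with hi'2 | hi'3
        · exact absurd (hi2.trans hi'2.symm) hii'
        · fin_cases r
          · left; rw [hi2]; simp [hρ]
          · right; rw [hi'3]; simp [hρ]
        · fin_cases r
          · right; rw [hi'2]; simp [hρ]
          · left; rw [hi3]; simp [hρ]
        · exact absurd (hi3.trans hi'3.symm) hii'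
      rw [← hptz v (r, c)]
      rcases hmem with h | h
      · rw [show ((ρ (r, c).1, (r, c).2) : Fin 4 × Fin 4) = (i, c) by rw [← h]]
        exact (hrows c).1
      · rw [show ((ρ (r, c).1, (r, c).2) : Fin 4 × Fin 4) = (i', c) by rw [← h]]
        exact (hrows c).2
    · -- two zero columns: impossible, row 0 of the point is all ones
      have : pt v (0, i) = 1 := by fin_cases i <;> simp [hpt, hAz]
      exact one_ne_zero (this ▸ (hcols 0).1)
  · -- nonsingular: differentiate `per₄ = Σ a_k a'_k` at the certified point
    set zs : Fin 2 × Fin 4 → ℂ := fun rc => ((Az (ρ rc.1) rc.2 : ℤ) : ℂ) with hzs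
    have hptzs : pt zs = fun e : Fin 4 × Fin 4 => ((Az e.1 e.2 : ℤ) : ℂ) := by
      funext ⟨i, c⟩
      fin_cases i <;> simp [hpt, hzs, hρ]
    -- the derivative identity: `w ᵥ* N = 0` with `w = (a'(A), a(A))`
    set wv : Fin 2 × Fin 4 → ℂ := fun bk =>
      if bk.1 = 0 then (N.mulVec zs) (1, bk.2) else (N.mulVec zs) (0, bk.2) with hwv
    have hderiv : ∀ rc : Fin 2 × Fin 4,
        eval (pt zs) (pderiv ((ρ rc.1, rc.2) : Fin 4 × Fin 4) (perPoly (Fin 4) ℂ)) = 0 := by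
      intro rc
      rw [hptzs, hρ]
      exact eval_pderiv_perPoly_certifiedPoint rc.1 rc.2
    have hvec : Matrix.vecMul wv N = 0 := by
      funext rc
      have h := hderiv rc
      rw [hf', map_sum, map_sum] at h
      simp only [pderiv_mul, map_add, map_mul] at h
      rw [Matrix.vecMul, dotProduct, Fintype.sum_prod_type, Fin.sum_univ_two]
      simp only [hwv, Fin.isValue, ↓reduceIte, one_ne_zero]
      rw [Pi.zero_apply, ← h]
      rw [← Finset.sum_add_distrib]
      refine Finset.sum_congr rfl fun k _ => ?_
      rw [← hφ0 k, ← hφ1 k, key2 zs (0, k) rc, key2 zs (1, k) rc, key1 zs (0, k), key1 zs (1, k)]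
      ring
    have hw0 : wv = 0 := Matrix.eq_zero_of_vecMul_eq_zero hdet hvec
    have hNzs : N.mulVec zs = 0 := by
      funext ⟨b, k⟩
      fin_cases b
      · have := congrFun hw0 (1, k)
        simpa [hwv] using this
      · have := congrFun hw0 (0, k)
        simpa [hwv] using this
    have hzs0 : zs ≠ 0 := by
      intro h
      have := congrFun h (1, 0)
      simp [hzs, hρ, hAz] at this
    exact hdet (Matrix.exists_mulVec_eq_zero_iff.1 ⟨zs, hzs0, hNzs⟩)

/-! ## ★ Stub C: `TopPrimeRigidity → TwoLineCase` -/

/-- ★ **Stub C of the line `component_rigidity` — the two-line case FROM top-prime rigidity** (the line's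
`stub_twoLineCase_of_topPrimeRigidity : TopPrimeRigidity → TwoLineCase`, both unfolded): if every prime `P ⊇ singPermIdeal ℂ 4`
of height `≤ 8` has all its quadrics in the variable ideal of some row `i ∪` column `c` or is the ideal of two rows / two
columns, then `per₄` has NO width-4 decomposition `Σ_{k<4} p_k q_k` by homogeneous quadrics all lying in the variable ideal
of two rows (resp. two columns).  Reduction to the rows `{0,1}` by a row permutation / the transpose
(`exists_decomposition_rename`), then `twoLineCase_rows01`. [cite: GesmundoGhosalIkenmeyerLysikov2022, Prop. 6] -/
theorem twoLineCase_of_topPrimeRigidity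
    (hB : ∀ P : Ideal (MvPolynomial (Fin 4 × Fin 4) ℂ), P.IsPrime →
      VonZurGathen.singPermIdeal ℂ 4 ≤ P → P.height ≤ 8 →
        (∃ i c : Fin 4, ∀ f ∈ P, f.IsHomogeneous 2 →
            f ∈ Ideal.span ((fun e => (X e : MvPolynomial (Fin 4 × Fin 4) ℂ)) ''
              ((Finset.univ.filter fun e : Fin 4 × Fin 4 => e.1 = i ∨ e.2 = c) : Set _))) ∨
        (∃ i i' : Fin 4, i ≠ i' ∧
          (P = Ideal.span ((fun e => (X e : MvPolynomial (Fin 4 × Fin 4) ℂ)) ''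
              ((Finset.univ.filter fun e : Fin 4 × Fin 4 => e.1 = i ∨ e.1 = i') : Set _)) ∨
           P = Ideal.span ((fun e => (X e : MvPolynomial (Fin 4 × Fin 4) ℂ)) ''
              ((Finset.univ.filter fun e : Fin 4 × Fin 4 => e.2 = i ∨ e.2 = i') : Set _))))) :
    ∀ i i' : Fin 4, i ≠ i' → ∀ S : Finset (Fin 4 × Fin 4),
      (S = (Finset.univ.filter fun e : Fin 4 × Fin 4 => e.1 = i ∨ e.1 = i') ∨
        S = (Finset.univ.filter fun e : Fin 4 × Fin 4 => e.2 = i ∨ e.2 = i')) →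
      ∀ p q : Fin 4 → MvPolynomial (Fin 4 × Fin 4) ℂ,
        (∀ k, p k ∈ Ideal.span ((fun e => (X e : MvPolynomial (Fin 4 × Fin 4) ℂ)) '' (S : Set _))) →
        (∀ k, q k ∈ Ideal.span ((fun e => (X e : MvPolynomial (Fin 4 × Fin 4) ℂ)) '' (S : Set _))) →
          ¬ ((∀ k, (p k).IsHomogeneous 2) ∧ (∀ k, (q k).IsHomogeneous 2) ∧
              perPoly (Fin 4) ℂ = ∑ k, p k * q k) := by
  -- the rows case for arbitrary `i ≠ i'`, by a row permutation
  have hrows : ∀ i i' : Fin 4, i ≠ i' → ∀ p q : Fin 4 → MvPolynomial (Fin 4 × Fin 4) ℂ,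
      (∀ k, p k ∈ Ideal.span ((fun e => (X e : MvPolynomial (Fin 4 × Fin 4) ℂ)) ''
        ((Finset.univ.filter fun e : Fin 4 × Fin 4 => e.1 = i ∨ e.1 = i') : Set _))) →
      (∀ k, q k ∈ Ideal.span ((fun e => (X e : MvPolynomial (Fin 4 × Fin 4) ℂ)) ''
        ((Finset.univ.filter fun e : Fin 4 × Fin 4 => e.1 = i ∨ e.1 = i') : Set _))) →
      ¬ ((∀ k, (p k).IsHomogeneous 2) ∧ (∀ k, (q k).IsHomogeneous 2) ∧
          perPoly (Fin 4) ℂ = ∑ k, p k * q k) := by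
    intro i i' hii' p q hp hq hpq
    obtain ⟨σ, hσi, hσi'⟩ := exists_perm_apply_eq_zero_one i i' hii'
    obtain ⟨p', q', hp', hq', hp2', hq2', hf'⟩ := exists_decomposition_rename
      (fun e : Fin 4 × Fin 4 => (σ e.1, e.2)) (rename_rowPerm_perPoly σ)
      (Finset.univ.filter fun e : Fin 4 × Fin 4 => e.1 = i ∨ e.1 = i')
      (Finset.univ.filter fun e : Fin 4 × Fin 4 => e.1 = 0 ∨ e.1 = 1)
      (by
        intro e he
        rw [Finset.mem_filter] at he ⊢
        rcases he.2 with h | h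
        · exact ⟨Finset.mem_univ _, Or.inl (by rw [h, hσi])⟩
        · exact ⟨Finset.mem_univ _, Or.inr (by rw [h, hσi'])⟩)
      p q hp hq hpq
    exact twoLineCase_rows01 hB p' q' hp' hq' ⟨hp2', hq2', hf'⟩
  intro i i' hii' S hS p q hp hq hpq
  rcases hS with rfl | rfl
  · exact hrows i i' hii' p q hp hq hpq
  · -- the columns case: transpose to the rows `i, i'`
    obtain ⟨p', q', hp', hq', hp2', hq2', hf'⟩ := exists_decomposition_rename
      (Prod.swap : Fin 4 × Fin 4 → Fin 4 × Fin 4) rename_swap_perPoly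
      (Finset.univ.filter fun e : Fin 4 × Fin 4 => e.2 = i ∨ e.2 = i')
      (Finset.univ.filter fun e : Fin 4 × Fin 4 => e.1 = i ∨ e.1 = i')
      (by
        intro e he
        rw [Finset.mem_filter] at he ⊢
        exact ⟨Finset.mem_univ _, by simpa using he.2⟩)
      p q hp hq hpq
    exact hrows i i' hii' p' q' hp' hq' ⟨hp2', hq2', hf'⟩

end TwoLine

end Summit.ValiantsHypothesis.ValiantsHypothesis.Theorems.PolyaContinuedLaplaceRigidity

end
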